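import Mathlib
import HarnessLib
import Summits.Langlands.Langlands.Theses.QuadraticWindow
import Summits.Langlands.Langlands.Theorems.TwistUnpackaging.Negative.CoherentCubicFamily
import Literature.NumberTheory.Automorphic.AutomorphicGaloisConjProofs
import Literature.NumberTheory.Automorphic.AutomorphicRepsGLCuspidalL2Step3bHolds
import Literature.NumberTheory.Automorphic.GLnAdelicStructureProofs
import Literature.Uncategorized.StubAdmissiblePowers

/-!
# `TwistUnpackaging` (stmt-Langlands-10903) — Negative knowledge VIII(b): stub B
# (`stub_admissiblePowers`) of the line `kummer-chebotarev-separating-twists` is FALSE as typed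
# (rank `n = 0`); repair: add `0 < n`

The registered skeleton `Cruxes/TwistUnpackaging/Lines/kummer-chebotarev-separating-twists.lean`
(sha `e396fa773a0d`) derives the crux from six stubs. Its stub B,
`…KummerChebotarevSeparatingTwists.stub_admissiblePowers` ("all but at most one power `ψʲ`,
`0 < j < p`, is robustly non-`τ`-invariant on `π`"), quantifies over EVERY rank `n` and every
cuspidal datum `π` of `GL_n/F`, without the crux's non-`τ`-invariance hypothesis `hnti` and without
`0 < n`. At `n = 0` every Satake parameter is the empty multiset (`HasSatakeParamAt.card_eq`), so
the clause `β.map (· * a') ≠ α.map (· * a)` of its conclusion reads `0 ≠ 0` and the conclusion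
collapses to `{1, …, p-1} ⊆ {j₀}`, absurd for `p ≥ 3`; while its hypotheses are satisfiable:

* `nonempty_cuspidalAutomorphicRepData_zero` — a cuspidal automorphic datum of the trivial group
  `GL_0` EXISTS (Dirac automorphic measure on the one-point quotient,
  `nonempty_cuspidalAutomorphicRepGL_zero`, and the PROVED Borel–Jacquet 4.6 bridge
  `AutomorphicRepsGL.exists_cuspidalRepData_of_L2_holds`);
* `exists_coherentFamily_not_tauInvariant` (`CoherentCubicFamily`) — a coherent cubic family
  `(Q, c, e, w₀)` over `ℚ(ζ₃)/ℚ` which is not `τ`-invariant (Kummer character of `∛2`).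

Hence `stubAdmissiblePowers_false : ¬ Literature.Uncategorized.StubAdmissiblePowers` (the refuted proposition is a
VERBATIM copy of the stub; the Cruxes work files are not importable modules), through the
Galois-side shadow `CoherentFamiliesTauInvariant` and
`coherentFamiliesTauInvariant_of_stubB : Literature.Uncategorized.StubAdmissiblePowers → Literature.Uncategorized.CoherentFamiliesTauInvariant`.
CLASS: stub-misstated (degenerate rank). REPAIR (minimal; the witness misses it): add the
hypothesis `0 < n` to stub B — free in the composition `TwistUnpackaging_of`, where `hnti` is
unsatisfiable at `n = 0` (`Cruxes/…/Disproof.lean`, `notTauInvariant_rank_zero_false`); the stub is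
true for `n ≥ 1` (paper proof in its docstring: `0 ∉ Sat`, `0 < n < p`, Chebotarev for the ratio
character). From the standing disprover's `Disproof.lean` (cdisprove gen 4, cycle 4). [folklore]
-/

open Literature.NumberTheory.GaloisRepresentations Literature.NumberTheory.Automorphic
open NumberField IsDedekindDomain Field Polynomial IntermediateField Filter MeasureTheory

namespace Summit.Langlands.Langlands.Theorems.TwistUnpackaging.Negative


/-- **Rank-0 cuspidal data exist** (the trivial group `GL_0`: `L²` of the one-point automorphic
quotient with the Dirac automorphic measure is a cuspidal automorphic representation,
`nonempty_cuspidalAutomorphicRepGL_zero`, and Borel–Jacquet 4.6 for `GL_n`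
(`AutomorphicRepsGL.exists_cuspidalRepData_of_L2_holds`, PROVED) turns it into a datum).
[folklore] -/
theorem nonempty_cuspidalAutomorphicRepData_zero (K : Type) [Field K] [NumberField K]
    (hcpt : isCompact_glFiniteIntegralLevel 0 K) :
    Nonempty (CuspidalAutomorphicRepData 0 K hcpt) := by
  let x : (AdelicGroupData.gl 0 K).automorphicQuotient :=
    (AdelicGroupData.gl 0 K).toAutomorphicQuotient 1
  haveI := isAutomorphicMeasure_dirac_gl_zero K x
  obtain ⟨P⟩ := nonempty_cuspidalAutomorphicRepGL_zero K (Measure.dirac x)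
  obtain ⟨π, -, -⟩ :=
    AutomorphicRepsGL.exists_cuspidalRepData_of_L2_holds hcpt (Measure.dirac x) P
  exact ⟨π⟩

/-- **Stub B forces `τ`-invariance of every coherent family** (instantiate at `n = 0`, where a
cuspidal datum exists and every Satake parameter is the empty multiset, so the stub's conclusion
`β.map _ ≠ α.map _` is `0 ≠ 0`: the stub then says "all `j ∈ (0,p)` but one are impossible",
absurd for `p ≥ 3`). [folklore] -/
theorem coherentFamiliesTauInvariant_of_stubB (h : Literature.Uncategorized.StubAdmissiblePowers) :
    Literature.Uncategorized.CoherentFamiliesTauInvariant := by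
  intro F₀ F _ _ _ _ _ τ hdeg hτ p Q c e hp hp3 hQ hc he w₀ hw₀ hτw₀
  by_contra hne
  obtain ⟨π⟩ := nonempty_cuspidalAutomorphicRepData_zero F
    (isCompact_glFiniteIntegralLevel_holds 0 F)
  obtain ⟨j₀, hj₀⟩ := h F₀ F τ hdeg hτ 0 _ π p Q c e hp hp.pos hQ hc he ⟨w₀, hw₀, hτw₀, hne⟩
  obtain ⟨j, hj0, hjp, hjj⟩ : ∃ j, 0 < j ∧ j < p ∧ j ≠ j₀ := by
    by_cases h1 : j₀ = 1
    · exact ⟨2, by omega, by omega, by omega⟩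
    · exact ⟨1, by omega, by omega, fun h => h1 h.symm⟩
  have hfreq := hj₀ j hj0 hjp hjj
  apply hfreq
  refine Filter.Eventually.of_forall fun w => ?_
  rintro ⟨α, β, a, a', hα, hβ, -, -, hne'⟩
  apply hne'
  rw [Multiset.card_eq_zero.1 hα.card_eq, Multiset.card_eq_zero.1 hβ.card_eq]
  simp

/-- Hence: **stub B is false as soon as one coherent family is not `τ`-invariant.** [folklore] -/
theorem stubAdmissiblePowers_false_of (h : ¬ Literature.Uncategorized.CoherentFamiliesTauInvariant) :
    ¬ Literature.Uncategorized.StubAdmissiblePowers :=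
  fun hB => h (coherentFamiliesTauInvariant_of_stubB hB)


/-- **`¬ Literature.Uncategorized.CoherentFamiliesTauInvariant`.** [folklore] -/
theorem coherentFamiliesTauInvariant_false : ¬ Literature.Uncategorized.CoherentFamiliesTauInvariant := by
  intro H
  obtain ⟨F, _, _, _, τ, hdeg, hτ, Q, c, e, hQ, hc, he, w₀, hw₀, hτw₀, hne⟩ :=
    exists_coherentFamily_not_tauInvariant
  exact hne (H ℚ F τ hdeg hτ 3 Q c e Nat.prime_three le_rfl hQ hc he w₀ hw₀ hτw₀)

/-- **Stub B of the skeleton is false** (rank `0` + the Kummer family). [folklore] -/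
theorem stubAdmissiblePowers_false : ¬ Literature.Uncategorized.StubAdmissiblePowers :=
  stubAdmissiblePowers_false_of coherentFamiliesTauInvariant_false


end Summit.Langlands.Langlands.Theorems.TwistUnpackaging.Negative
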